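import Literature.MathematicalPhysics.QuantumFieldTheory.Balaban1983to89.B6Eq238MultiLevelBox
import Literature.MathematicalPhysics.QuantumFieldTheory.Balaban1983to89.B6Ineq249TwoLevelBox

/-!
# `Balaban1983to89.B6Ineq249MultiLevelBox` — [B6] (2.49) `|Rλ| ≤ O(M^{−1})|λ|` AND (2.50)
`G′ = G′₀(I − R)^{−1} = G′₀Σ_nRⁿ`, convergent in the `L^∞` operator norm, FOR THE GENUINE `k`-LEVEL OPERATOR `Δ′_a`
ON A BOX (file 3 of the multi-level parametrix: the printed route (2.38) → (2.44) per cube → (2.49) → (2.50) for the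
multi-size cover of `B6Eq238MultiLevelBox`; no existing module is touched; no fact is minted)

FRAMING (verbatim cell line):
statement-level skeleton of published theorems with citation tags; proofs where landed; nothing here is a claim about the Yang–Mills mass gap

Source under audit (cell pub-balaban / lit-balaban): T. Bałaban, *Propagators and renormalization transformations for
lattice gauge theories. II*, Commun. Math. Phys. **96** (1984) 223–250 [`Balaban1984PropagatorsII`, "B6"], p. 230 [PDF 8]
(2.44), p. 232 [PDF 10] (2.49)–(2.50), p. 234 [PDF 12] Proposition 2.2 (last sentence) (renders
`run/shared/lean/pub/pub-balaban/b2b-balaban-ref1/pages/1984-cmp96-propagators-rt-II/…-p008/p010/p012-x2.png`, read as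
images this generation).  Unit `lit-balaban-p21` (Phase-2 proof seat p21 gen 10), HOME `run/shared/lean/pub/lit-balaban/`,
B6 fold owner r03, referee ref-4.  v1.1 (docfix S-B6-g36-1, ref-4 g36): the Proposition 2.2 sentence is now quoted
VERBATIM and no longer attributed an `L^∞` reading (the `L^∞` sentence this file certifies is p. 232's); no declaration
changed.

## WHAT IS PRINTED (p. 232, verbatim up to notation)

«Now let us come back to the inequality (2.44) and its consequences. One of them follows from the equality (2.38) where
the operator R was defined. We get |Rλ| ≤ O(M^{−1})|λ|, (2.49) thus the operator R has a small norm in the space L^∞ for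
M sufficiently large, and we get G′ = G′₀(I − R)^{−1} = G′₀Σ_{n=0}^∞ Rⁿ = … (2.50) … Both series above are convergent
in the space L^∞».  (p. 234, Proposition 2.2, last sentence, verbatim: «The random walk representation (2.50) is
convergent in the norms defined by these inequalities» — the norms of (2.67); that sentence is NOT certified in this file,
which certifies the p. 232 `L^∞` sentence only.)

## WHAT THIS FILE CERTIFIES (kernel-checked; setting of `B6MultiLevelBoxOperator`/`B6Eq238MultiLevelBox`)

For a nested family `D : Domains d ℓ M_h k P R` (levels `1 … k`, (2.1)–(2.2) with `R ≥ 2L`), weights `a_i ∈ [a₋, a₊]`,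
`c_i ∈ [c₋, c₊]` (`i ≥ 1`), the `k`-level operator `Δ′_a = mlOp` on the box `X = Π[0, L^k·L·M_h·P_μ)` and the cover
`𝒟`, `G′₀ = gZeroML`, `R = rML` of file 2, in the matrix ring of `X` with Mathlib's `ℓ^∞ → ℓ^∞` operator norm (scope
`Matrix.Norms.Operator`, the printed «norm in the space L^∞»):
* §1 norm tools (a sum with at most `|T|` non-zero terms; `‖1‖ ≤ 1`);
* §2 **THE ROW SUPPORT OF A COMMUTATOR CUBE TERM** `resᵀ(K_□(h_□)·T)res` for ANY `T` (`abs_lt_of_commPad_ne_zero`, the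
  two-level-box lemma of `B6Ineq249TwoLevelBox` freed from its right factor): non-zero at `x` only if
  `|x_μ + ½ − Nq_μ| < N` (`N` the cube half-width, `M_h ≥ 3`);
* §3 **(2.44) WITH ANY BOUNDED RIGHT FACTOR** `local_comm_bound` (two-level-box vocabulary, decaying form:
  `|(K_q(h_q)G′(□_q)w·u)(y)| ≤ C(d+1)(sup|h′| + sup|h″|)/M·e^{−δ′D/L^k}·F` for `|w| ≤ 1`, `|u| ≤ F` supported at distance
  `≥ D`, from gen-7's `B6Ineq243TwoLevelBox.ineq244_twoLevel` with the sizes `κ₁ = (d+1)sup|h′|/M`, `κ₂ = (d+1)sup|h″|/M²`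
  of the printed cut-off) and **(2.49) FOR THE GENUINE `k`-LEVEL OPERATOR** `norm_rML_le`: there is
  `C′ = C′(d, ℓ, windows) > 0` with `‖R‖_{∞→∞} ≤ C′/M` (`M = L·M_h`) for EVERY `k`, `M_h ≥ 3`, `R ≥ 2L`, volume `P`,
  nested family `D` and weights in the windows — each term `K(h_□)G′(□)v_□` of `R` is bounded by (2.44) on ITS cube (a
  genuine two-level cube operator at the cube's finer level `i ≥ 1`, half-width `M_□ = M·L^{j−i} ≥ M`, `|v_□| ≤ 1`), and
  at most `3·2^{d+1}` terms meet a row (levels `lev x − 1 … lev x + 1` by the two-level window of file 2, `2^{d+1}`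
  cubes per level by §2, `mem_keySet_of_bX_ne_zero`);
* §4 **(2.50)** `eq250_multiLevelBox`: for `M ≥ M₀ = 2C′` («M sufficiently large»): `‖R‖ ≤ ½`; the Neumann series
  `G′₀Σ'_nRⁿ` is a right inverse of `Δ′_a` ((2.38) of file 2 and `(1 − R)Σ'Rⁿ = 1`); it EQUALS `G′ = Δ′_a^{−1} = gml` of
  file 1; and `Σ_n G′₀Rⁿ` CONVERGES to `G′` in the `ℓ^∞` operator norm — uniformly in `k`, `P`, `D` and the weights
  (`a_{i+1} = aNext ℓ a_i c_i`); with the weight-at-level-0 bookkeeping `mlOp_congr_weights` (the level-0 term of `mlOp`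
  vanishes since every site has level `≥ 1`, so only `a_i`, `i ≥ 1`, matter).

## HONEST SCOPE

As files 1–2: levels `1 … k` (print's `Λ₀`, `a₀ = +∞` not modelled), Neumann box for the torus, `m² = 0`, the
asymmetric partition `u_□ = h_□`, `v_□ = h_□·1_{B^j(Λ_j)}`; `M_h ≥ 3` for the row count; constants existential
(functions of `d`, `ℓ` and the windows).  The operator is in lattice units (`Δ′_a` of print times `η²`), so `R` and the
statements here are scale-free while `G′₀`, `G′` carry `η^{−2}`; no uniform bound of `‖G′‖` is claimed here (that is
(2.67) with its weights, files 4–5).  The walk form of (2.50) (third member) is `B6Eq250.neumann250_walks` (abstract) and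
is not re-derived for this cover.  Nothing is inferred from the manuscript: every step is kernel-checked.
-/

namespace Literature.MathematicalPhysics.QuantumFieldTheory.Balaban1983to89.B6Ineq249MultiLevelBox

open Finset Matrix
open scoped Matrix.Norms.Operator
open Literature.MathematicalPhysics.QuantumFieldTheory.Balaban1983to89.B4ContourShift (supNorm abs_le_supNorm
  supNorm_nonneg)
open Literature.MathematicalPhysics.QuantumFieldTheory.Balaban1983to89.B4Reflection242 (boxDom mem_boxDom nbrs mem_nbrs
  blk neumannLapK diagK avgK)
open Literature.MathematicalPhysics.QuantumFieldTheory.Balaban1983to89.B4Green242Bridge (boxNbrs)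
open Literature.MathematicalPhysics.QuantumFieldTheory.Balaban1983to89.B4Lemma22ReduceZero (Box)
open Literature.MathematicalPhysics.QuantumFieldTheory.Balaban1983to89.B4PartitionUnity22 (hprof D1 D2 D1_nonneg D2_nonneg
  contDiff_hprof hasCompactSupport_hprof)
open Literature.MathematicalPhysics.QuantumFieldTheory.Balaban1983to89.B4Thm110ZeroBox (boxCast boxCast_apply_val
  boxCast_symm_apply_val blk_blk mem_boxDom_of_eq)
open Literature.MathematicalPhysics.QuantumFieldTheory.Balaban1983to89.B6Ineq243TwoLevelBox
open Literature.MathematicalPhysics.QuantumFieldTheory.Balaban1983to89.B6Partition236TwoLevelBox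
open Literature.MathematicalPhysics.QuantumFieldTheory.Balaban1983to89.B6Eq238TwoLevelBox
open Literature.MathematicalPhysics.QuantumFieldTheory.Balaban1983to89.B6Ineq249TwoLevelBox (linfty_opNorm_le_of_pointwise
  near card_near_le mem_near_of_abs_lt supNorm_le_of_twoLevelOp_ne_zero pos_emb pos_emb_sub pad_mulVec_apply_le)
open Literature.MathematicalPhysics.QuantumFieldTheory.Balaban1983to89.B6MultiLevelBoxOperator
open Literature.MathematicalPhysics.QuantumFieldTheory.Balaban1983to89.B6Eq238MultiLevelBox

noncomputable section

variable {d : ℕ}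

/-! ## §1 Norm tools -/

section NormTools

variable {m m' : Type*} [Fintype m] [Fintype m']

/-- `|v(j)| ≤ ‖v‖_∞`. [folklore] -/
private theorem abs_apply_le_norm (v : m' → ℝ) (j : m') : |v j| ≤ ‖v‖ := by
  have := norm_le_pi_norm v j
  rwa [Real.norm_eq_abs] at this

/-- a sum of terms `≤ B` (`B ≥ 0`), with at most the terms keyed (injectively) into `T` non-zero, is `≤ |T|·B`. [folklore] -/
private theorem sum_le_card_mul {ι σ : Type*} [Fintype ι] [DecidableEq σ] (f : ι → ℝ) (key : ι → σ)
    (hkey : Function.Injective key) (T : Finset σ) (hT : ∀ i, f i ≠ 0 → key i ∈ T) {B : ℝ} (hB : 0 ≤ B)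
    (hf : ∀ i, f i ≤ B) : ∑ i, f i ≤ T.card * B := by
  classical
  rw [← Finset.sum_filter_ne_zero]
  have hcard : (Finset.univ.filter fun i => f i ≠ 0).card ≤ T.card :=
    Finset.card_le_card_of_injOn key (fun i hi => by
      rw [Finset.coe_filter] at hi; exact hT i hi.2) (fun i _ j _ h => hkey h)
  calc ∑ i ∈ Finset.univ.filter (fun i => f i ≠ 0), f i
      ≤ (Finset.univ.filter fun i => f i ≠ 0).card • B := Finset.sum_le_card_nsmul _ _ _ fun i _ => hf i
    _ = ((Finset.univ.filter fun i => f i ≠ 0).card : ℝ) * B := by rw [nsmul_eq_mul]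
    _ ≤ T.card * B := by gcongr

/-- `‖1‖_{∞→∞} ≤ 1`. [folklore] -/
private theorem linfty_opNorm_one_le [DecidableEq m] : ‖(1 : Matrix m m ℝ)‖ ≤ 1 :=
  linfty_opNorm_le_of_pointwise _ zero_le_one fun v i => by rw [Matrix.one_mulVec, one_mul]; exact abs_apply_le_norm v i

/-- `(reindex e e A)·v` at `z` is `A·(v ∘ e)` at `e⁻¹z`. [folklore] -/
private theorem reindex_mulVec_apply {X Y : Type*} [Fintype X] [Fintype Y] (e : X ≃ Y) (A : Matrix X X ℝ) (v : Y → ℝ)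
    (z : Y) : (Matrix.reindex e e A *ᵥ v) z = (A *ᵥ (v ∘ e)) (e.symm z) := by
  rw [Matrix.reindex_apply, Matrix.submatrix_mulVec_equiv, Equiv.symm_symm, Function.comp_apply]

end NormTools

/-! ## §2 The row support of a commutator cube term (any right factor) -/

section Support

variable {ℓ k Mh : ℕ} {P : Fin (d + 1) → ℕ} {q : Fin (d + 1) → ℤ}

/-- **THE ROW SUPPORT OF A COMMUTATOR CUBE TERM**: if `(resᵀ(K_q(h_q)·T)res·v)(x) ≠ 0` for the cut cube `□_q` of a box
of `L`-blocks (mesh `L^{−k}`, cube half-width `N = L^k·L·M_h` fine sites, `E_q` a two-level cube operator with ANY block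
union of the cube, `T` ANY matrix on the cube), then `|x_μ + ½ − Nq_μ| < N` for every `μ` — the commutator row at `x`
needs a site `x″` coupled to `x` by `E_q` (sup-distance `≤ L^k·L`) with `h_q(x″) ≠ h_q(x)`, hence `h_q ≠ 0` at `x` or `x″`
(radius `⅝N`), and `L^k·L ≤ ⅜N` for `M_h ≥ 3`. [cite: Balaban1984PropagatorsII, (2.44) p.230, p.229 (cover of finite overlap)] -/
theorem abs_lt_of_commPad_ne_zero (hℓ : 1 ≤ ℓ) (hMh : 3 ≤ Mh) (hP : ∀ i, 1 ≤ P i) (hq : q ∈ ctrs P) (aj a m2 : ℝ)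
    {Λ' : Finset ↥(boxDom (fun i => (ℓ + 1) * cubeM' Mh P q i))} (hΛ' : IsBlockUnion ℓ (cubeM' Mh P q) Λ')
    (T : Matrix ↥(Box d ℓ k (fun i => (ℓ + 1) * cubeM' Mh P q i)) ↥(Box d ℓ k (fun i => (ℓ + 1) * cubeM' Mh P q i)) ℝ)
    (v : ↥(Box d ℓ k (fun i => (ℓ + 1) * (Mh * P i))) → ℝ) {x : ↥(Box d ℓ k (fun i => (ℓ + 1) * (Mh * P i)))}
    (hx : (((res (emb ℓ k Mh P q hP hq))ᵀ
            * (kComm (twoLevelOp ((ℓ + 1) ^ k) ℓ aj a m2 (cubeM' Mh P q) Λ') (hLoc ℓ k Mh P q) * T)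
            * res (emb ℓ k Mh P q hP hq)) *ᵥ v) x ≠ 0) (μ : Fin (d + 1)) :
    |pos x.1 μ - (((ℓ + 1) ^ k * ((ℓ + 1) * Mh) : ℕ) : ℝ) * q μ| < (((ℓ + 1) ^ k * ((ℓ + 1) * Mh) : ℕ) : ℝ) := by
  have hn1 : 1 ≤ (ℓ + 1) ^ k := Nat.one_le_pow _ _ (by omega)
  have hN1 : 1 ≤ (ℓ + 1) ^ k * ((ℓ + 1) * Mh) := Nat.one_le_iff_ne_zero.2 (by positivity)
  have hinj := emb_injective (ℓ := ℓ) (k := k) (Mh := Mh) hP hq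
  set N : ℕ := (ℓ + 1) ^ k * ((ℓ + 1) * Mh) with hNdef
  rw [← Matrix.mulVec_mulVec, ← Matrix.mulVec_mulVec] at hx
  -- the site lies in the cube: `x = emb y`
  obtain ⟨y, rfl⟩ : ∃ y, emb ℓ k Mh P q hP hq y = x := by
    by_contra hne
    push Not at hne
    exact hx (transpose_res_mulVec_off _ _ hne)
  rw [transpose_res_mulVec_img hinj, ← Matrix.mulVec_mulVec, kComm_mulVec] at hx
  obtain ⟨b, -, hb⟩ := Finset.exists_ne_zero_of_sum_ne_zero hx
  have hEyb : twoLevelOp ((ℓ + 1) ^ k) ℓ aj a m2 (cubeM' Mh P q) Λ' y b ≠ 0 := by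
    intro h0; apply hb; rw [h0]; ring
  have hhyb : hLoc ℓ k Mh P q y ≠ hLoc ℓ k Mh P q b := by
    intro h0; apply hb; rw [h0]; ring
  have hdist : supNorm (y.1 - b.1) ≤ ((((ℓ + 1) ^ k : ℕ) : ℝ)) * ((ℓ : ℝ) + 1) :=
    supNorm_le_of_twoLevelOp_ne_zero hn1 aj a m2 hΛ' hEyb
  -- `h_q ≠ 0` at `y` or at `b`
  have hc : ∃ c : ↥(Box d ℓ k (fun i => (ℓ + 1) * cubeM' Mh P q i)),
      hLoc ℓ k Mh P q c ≠ 0 ∧ supNorm (y.1 - c.1) ≤ ((((ℓ + 1) ^ k : ℕ) : ℝ)) * ((ℓ : ℝ) + 1) := by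
    by_cases hy0 : hLoc ℓ k Mh P q y = 0
    · exact ⟨b, fun hb0 => hhyb (by rw [hy0, hb0]), hdist⟩
    · refine ⟨y, hy0, ?_⟩
      rw [sub_self, B4BoxCov237.supNorm_zero']; positivity
  obtain ⟨c, hc0, hyc⟩ := hc
  have hrad := abs_lt_of_hq_ne_zero hN1 hc0 μ
  rw [← pos_emb_sub hP hq c μ] at hrad
  have hdiff : |pos (emb ℓ k Mh P q hP hq y).1 μ - pos (emb ℓ k Mh P q hP hq c).1 μ|
      ≤ ((((ℓ + 1) ^ k : ℕ) : ℝ)) * ((ℓ : ℝ) + 1) := by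
    rw [pos_emb hP hq, pos_emb hP hq, add_sub_add_right_eq_sub]
    have h1 := abs_le_supNorm (y.1 - c.1) μ
    rw [Pi.sub_apply] at h1
    push_cast at h1
    have e : pos y.1 μ - pos c.1 μ = ((y.1 μ : ℤ) : ℝ) - ((c.1 μ : ℤ) : ℝ) := by simp only [pos]; ring
    rw [e]
    exact h1.trans hyc
  have hNL : ((((ℓ + 1) ^ k : ℕ) : ℝ)) * ((ℓ : ℝ) + 1) ≤ 3 / 8 * (N : ℝ) := by
    rw [hNdef]; push_cast
    have hMh' : (3 : ℝ) ≤ Mh := by exact_mod_cast hMh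
    have h0 : (0 : ℝ) ≤ (((ℓ : ℝ) + 1) ^ k) * ((ℓ : ℝ) + 1) := by positivity
    nlinarith
  calc |pos (emb ℓ k Mh P q hP hq y).1 μ - (N : ℝ) * q μ|
      = |(pos (emb ℓ k Mh P q hP hq y).1 μ - pos (emb ℓ k Mh P q hP hq c).1 μ)
          + (pos (emb ℓ k Mh P q hP hq c).1 μ - (N : ℝ) * q μ)| := by ring_nf
    _ ≤ |pos (emb ℓ k Mh P q hP hq y).1 μ - pos (emb ℓ k Mh P q hP hq c).1 μ|
          + |pos (emb ℓ k Mh P q hP hq c).1 μ - (N : ℝ) * q μ| := abs_add_le _ _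
    _ < 3 / 8 * (N : ℝ) + 5 / 8 * (N : ℝ) := add_lt_add_of_le_of_lt (hdiff.trans hNL) hrad
    _ = N := by ring

end Support

/-! ## §3 (2.49) `‖R‖ ≤ O(M^{−1})` for the genuine `k`-level operator, uniformly in `k`, the volume and the domains -/

section Ineq249

variable {ℓ Mh k R : ℕ} {P : Fin (d + 1) → ℕ} (D : Domains d ℓ Mh k P R) (a c : ℕ → ℝ)

/-- the embedding of the cut cube of a member of the cover (presentation at its finer level).
[cite: Balaban1983RegularityDecay, §2 p.575, dictionary] -/
def embC (hP : ∀ μ, 1 ≤ P μ) (cq : ℕ × (Fin (d + 1) → ℤ)) (hc : CubeData D cq) :=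
  emb ℓ (fin D cq.1 cq.2) (MhP ℓ Mh cq.1 (fin D cq.1 cq.2)) (Pj ℓ k P cq.1) cq.2 (one_le_Pj hP cq.1) hc.hq

/-- the padded local commutator term `resᵀ(K_□(h_□)G′(□)v′_□)res` of a member of the cover, on its presentation (the
matrix transported by `bX`). [cite: Balaban1984PropagatorsII, (2.38) p.229, (2.44) p.230] -/
def innerB (hP : ∀ μ, 1 ≤ P μ) (cq : ℕ × (Fin (d + 1) → ℤ)) (hc : CubeData D cq) :
    Matrix ↥(Box d ℓ (fin D cq.1 cq.2) (fun μ => (ℓ + 1) * (MhP ℓ Mh cq.1 (fin D cq.1 cq.2) * Pj ℓ k P cq.1 μ)))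
      ↥(Box d ℓ (fin D cq.1 cq.2) (fun μ => (ℓ + 1) * (MhP ℓ Mh cq.1 (fin D cq.1 cq.2) * Pj ℓ k P cq.1 μ))) ℝ :=
  (res (embC D hP cq hc))ᵀ
    * (kComm (cOp D a c cq.1 (fin D cq.1 cq.2) cq.2 hP hc.hq)
          (hLoc ℓ (fin D cq.1 cq.2) (MhP ℓ Mh cq.1 (fin D cq.1 cq.2)) (Pj ℓ k P cq.1) cq.2)
        * cG D a c cq.1 (fin D cq.1 cq.2) cq.2 hP hc.hq
        * Matrix.diagonal ((fun z => vFun D cq.1 cq.2 z.1) ∘ embC D hP cq hc))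
    * res (embC D hP cq hc)

variable {D a c}

/-- `bX` is `innerB` transported by the cast. [cite: Balaban1984PropagatorsII, (2.38) p.229, dictionary] -/
theorem bX_eq (hP : ∀ μ, 1 ≤ P μ) (cq : ℕ × (Fin (d + 1) → ℤ)) (hc : CubeData D cq) :
    bX D a c hP cq hc
      = Matrix.reindex (castP (fin_data hc).2.1 hc.hj.2) (castP (fin_data hc).2.1 hc.hj.2) (innerB D a c hP cq hc) :=
  rfl

/-- a row of `bX` is a row of `innerB`. [cite: Balaban1984PropagatorsII, (2.38) p.229, dictionary] -/
theorem bX_mulVec_apply (hP : ∀ μ, 1 ≤ P μ) (cq : ℕ × (Fin (d + 1) → ℤ)) (hc : CubeData D cq)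
    (v : ↥(boxDom (N0 ℓ Mh k P)) → ℝ) (z : ↥(boxDom (N0 ℓ Mh k P))) :
    (bX D a c hP cq hc *ᵥ v) z
      = (innerB D a c hP cq hc *ᵥ (v ∘ castP (fin_data hc).2.1 hc.hj.2))
          ((castP (ℓ := ℓ) (Mh := Mh) (fin_data hc).2.1 hc.hj.2).symm z) := by
  rw [bX_eq, reindex_mulVec_apply]

/-- `|v_□| ≤ 1`. [cite: Balaban1984PropagatorsII, (2.36) p.229; Balaban1984PropagatorsI, (1.118) p.36] -/
theorem abs_vFun_le_one (j : ℕ) (q z : Fin (d + 1) → ℤ) : |vFun D j q z| ≤ 1 := by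
  unfold vFun uFun
  rw [abs_mul]
  have h1 := abs_hq_le_one ((ℓ + 1) ^ j) ((ℓ + 1) * Mh) q z
  have h2 : |(if D.lev z = j then (1 : ℝ) else 0)| ≤ 1 := by split_ifs <;> simp
  calc |hq ((ℓ + 1) ^ j) ((ℓ + 1) * Mh) q z| * |(if D.lev z = j then (1 : ℝ) else 0)| ≤ 1 * 1 :=
        mul_le_mul h1 h2 (abs_nonneg _) zero_le_one
    _ = 1 := one_mul _

/-- the at most `3·2^{d+1}` members of the cover whose commutator term can meet the row of a site of level `l`:
levels `l − 1 … l + 1`, candidate centres `near`. [cite: Balaban1984PropagatorsII, p.229 (cover of finite overlap), (2.2) p.224] -/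
def keySet (ℓ Mh l : ℕ) (z : Fin (d + 1) → ℤ) : Finset (ℕ × (Fin (d + 1) → ℤ)) :=
  (Finset.Icc (l - 1) (l + 1)).biUnion fun j => (near (bigSide ℓ Mh j) z).image (Prod.mk j)

/-- at most `3·2^{d+1}` keys. [cite: Balaban1984PropagatorsII, p.229, dictionary] -/
theorem card_keySet_le (ℓ Mh l : ℕ) (z : Fin (d + 1) → ℤ) : (keySet (d := d) ℓ Mh l z).card ≤ 3 * 2 ^ (d + 1) := by
  unfold keySet
  calc ((Finset.Icc (l - 1) (l + 1)).biUnion fun j => (near (bigSide ℓ Mh j) z).image (Prod.mk j)).card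
      ≤ ∑ j ∈ Finset.Icc (l - 1) (l + 1), ((near (bigSide ℓ Mh j) z).image (Prod.mk j)).card :=
        Finset.card_biUnion_le
    _ ≤ ∑ _j ∈ Finset.Icc (l - 1) (l + 1), 2 ^ (d + 1) :=
        Finset.sum_le_sum fun j _ => Finset.card_image_le.trans (card_near_le _ _)
    _ = (Finset.Icc (l - 1) (l + 1)).card * 2 ^ (d + 1) := by rw [Finset.sum_const, smul_eq_mul]
    _ ≤ 3 * 2 ^ (d + 1) := Nat.mul_le_mul_right _ (by rw [Nat.card_Icc]; omega)

/-- membership in the key set. [cite: Balaban1984PropagatorsII, p.229, dictionary] -/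
theorem mem_keySet {ℓ Mh l : ℕ} {z : Fin (d + 1) → ℤ} {cq : ℕ × (Fin (d + 1) → ℤ)} (h1 : l ≤ cq.1 + 1)
    (h2 : cq.1 ≤ l + 1) (hn : cq.2 ∈ near (bigSide ℓ Mh cq.1) z) : cq ∈ keySet ℓ Mh l z := by
  unfold keySet
  rw [Finset.mem_biUnion]
  exact ⟨cq.1, Finset.mem_Icc.2 ⟨by omega, h2⟩, Finset.mem_image.2 ⟨cq.2, hn, rfl⟩⟩

/-- **THE ROW SUPPORT OF A TERM OF `R`**: if `(K(h_□)G′(□)v_□·v)(z) ≠ 0` for the member `□ = (j, q)` of the cover, then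
`j ∈ {lev z − 1, lev z, lev z + 1}` (the row lies in the cube, whose sites have level `i` or `i + 1`, `i ∈ {j − 1, j}`
its finer level — the two-level window of file 2) and `q` is one of the `2^{d+1}` candidate centres at `z` (§2).
[cite: Balaban1984PropagatorsII, p.229 (cover of finite overlap), (2.2) p.224, (2.44) p.230] -/
theorem mem_keySet_of_bX_ne_zero (hℓ : 1 ≤ ℓ) (hR : 2 * (ℓ + 1) ≤ R) (hP : ∀ μ, 1 ≤ P μ) (hMh : 3 ≤ Mh)
    (cq : ℕ × (Fin (d + 1) → ℤ)) (hc : CubeData D cq) (v : ↥(boxDom (N0 ℓ Mh k P)) → ℝ)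
    {z : ↥(boxDom (N0 ℓ Mh k P))} (hz : (bX D a c hP cq hc *ᵥ v) z ≠ 0) :
    cq ∈ keySet ℓ Mh (D.lev z.1) z.1 := by
  obtain ⟨hi1, hij, hji, hdown, hup⟩ := fin_data hc
  have hjk := hc.hj.2
  have hMh1 : 1 ≤ Mh := le_trans (by norm_num) hMh
  have hMh' : 3 ≤ MhP ℓ Mh cq.1 (fin D cq.1 cq.2) :=
    le_trans hMh (Nat.le_mul_of_pos_right _ (by positivity))
  rw [bX_mulVec_apply] at hz
  -- the row lies in the cube
  have hzval : ((castP (ℓ := ℓ) (Mh := Mh) (P := P) hij hjk).symm z).1 = z.1 := by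
    unfold castP; exact boxCast_symm_apply_val _ _
  obtain ⟨y, hy⟩ : ∃ y, embC D hP cq hc y = (castP (ℓ := ℓ) (Mh := Mh) (P := P) hij hjk).symm z := by
    by_contra hne
    push Not at hne
    apply hz
    unfold innerB
    rw [← Matrix.mulVec_mulVec, ← Matrix.mulVec_mulVec]
    exact transpose_res_mulVec_off _ _ hne
  -- (a) the level window
  have hwin := window_of_active (D := D) hℓ hR hP hMh1 hi1 hij hjk hc.hq hc.hact hdown hup y
  have hyz : (embC D hP cq hc y).1 = z.1 := by rw [hy, hzval]
  unfold embC at hyz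
  rw [hyz] at hwin
  -- (b) the candidate centres
  have hsupp : ∀ μ, |pos z.1 μ - ((bigSide ℓ Mh cq.1 : ℕ) : ℝ) * cq.2 μ| < ((bigSide ℓ Mh cq.1 : ℕ) : ℝ) := by
    intro μ
    have h := abs_lt_of_commPad_ne_zero (k := fin D cq.1 cq.2) hℓ hMh' (one_le_Pj hP cq.1) hc.hq
      (a (fin D cq.1 cq.2)) (c (fin D cq.1 cq.2)) 0
      (isBlockUnion_lamLoc _ hc.hq (isBlockUnion_LamG (D := D) hij hjk))
      (cG D a c cq.1 (fin D cq.1 cq.2) cq.2 hP hc.hq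
        * Matrix.diagonal ((fun z => vFun D cq.1 cq.2 z.1) ∘ embC D hP cq hc))
      (v ∘ castP (fin_data hc).2.1 hc.hj.2) (x := (castP (ℓ := ℓ) (Mh := Mh) (P := P) hij hjk).symm z)
      (by
        unfold innerB cOp embC at hz
        rw [Matrix.mul_assoc (kComm _ _)] at hz
        exact hz) μ
    rw [halfWidth_eq hij, hzval] at h
    exact h
  exact mem_keySet (by omega) (by omega) (mem_near_of_abs_lt (one_le_bigSide hMh1 cq.1) hsupp)

/-- the geometry `N = L^i·L·M′ ≥ 4`. [folklore] -/
private theorem four_le_N (hℓ : 1 ≤ ℓ) {i M' : ℕ} (hi : 1 ≤ i) (hM : 1 ≤ M') : 4 ≤ (ℓ + 1) ^ i * ((ℓ + 1) * M') := by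
  have h2 : 2 ≤ (ℓ + 1) ^ i := by
    calc 2 = 2 ^ 1 := by norm_num
      _ ≤ (ℓ + 1) ^ 1 := Nat.pow_le_pow_left (by omega) 1
      _ ≤ (ℓ + 1) ^ i := Nat.pow_le_pow_right (by omega) hi
  have : 2 ≤ (ℓ + 1) * M' := by nlinarith
  nlinarith

/-- **(2.44) FOR A COMMUTATOR CUBE TERM WITH ANY BOUNDED RIGHT FACTOR** (two-level-box vocabulary): there are
`δ′, C > 0` (depending on `d`, `ℓ` and the windows) such that for every mesh `L^{−k}`, `k ≥ 1`, window point (`m² = 0`),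
`M_h ≥ 1`, volume, cut cube `□_q` with ANY block union `Λ′` of the cube, right factor `|w| ≤ 1` and vector `|u| ≤ F`
supported at sup-distance `≥ D` from `y`:
`|(K_q(h_q)G′(□_q)w·u)(y)| ≤ C·((d+1)(sup|h′| + sup|h″|)/M)·e^{−δ′D/L^k}·F`, `M = L·M_h` — gen-7's
`B6Ineq243TwoLevelBox.ineq244_twoLevel` with the sizes `κ₁ = (d+1)sup|h′|/M`, `κ₂ = (d+1)sup|h″|/M² ≤ (d+1)sup|h″|/M` of
the printed cut-off (`B6Partition236TwoLevelBox.abs_hq_sub_le`/`hloc_laplacian`).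
[cite: Balaban1984PropagatorsII, (2.44) p.230, (2.49)/(2.51) p.232] -/
theorem local_comm_bound (d ℓ : ℕ) (hℓ : 1 ≤ ℓ) (aminus aplus a2minus a2plus : ℝ) (ha : 0 < aminus)
    (ha2 : 0 < a2minus) :
    ∃ δ' C : ℝ, 0 < δ' ∧ 0 < C ∧ ∀ (k : ℕ), 1 ≤ k → ∀ (aj a : ℝ), aminus ≤ aj → aj ≤ aplus → a2minus ≤ a →
      a ≤ a2plus → ∀ (Mh : ℕ), 1 ≤ Mh → ∀ (P : Fin (d + 1) → ℕ) (hP : ∀ i, 1 ≤ P i) (q : Fin (d + 1) → ℤ)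
        (hq : q ∈ ctrs P) (Λ' : Finset ↥(boxDom (fun i => (ℓ + 1) * cubeM' Mh P q i))),
        IsBlockUnion ℓ (cubeM' Mh P q) Λ' →
        ∀ (w u : ↥(Box d ℓ k (fun i => (ℓ + 1) * cubeM' Mh P q i)) → ℝ) (F Dd : ℝ), (∀ b, |w b| ≤ 1) →
          (∀ b, |u b| ≤ F) → ∀ y : ↥(Box d ℓ k (fun i => (ℓ + 1) * cubeM' Mh P q i)),
          (∀ b, u b ≠ 0 → Dd ≤ supNorm (y.1 - b.1)) →
          |((kComm (twoLevelOp ((ℓ + 1) ^ k) ℓ aj a 0 (cubeM' Mh P q) Λ') (hLoc ℓ k Mh P q)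
              * gTwoLevel ((ℓ + 1) ^ k) ℓ aj a 0 (cubeM' Mh P q) Λ' * Matrix.diagonal w) *ᵥ u) y|
            ≤ C * ((d + 1) * (D1 hprof + D2 hprof) / (((ℓ : ℝ) + 1) * Mh))
                * Real.exp (-(δ' * Dd / (((ℓ + 1) ^ k : ℕ) : ℝ))) * F := by
  obtain ⟨δ', C, hδ', hC, h244⟩ := ineq244_twoLevel d ℓ hℓ aminus aplus 0 a2minus a2plus ha ha2
  have hD1 := D1_nonneg contDiff_hprof hasCompactSupport_hprof
  have hD2 := D2_nonneg contDiff_hprof hasCompactSupport_hprof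
  refine ⟨δ', C, hδ', hC, ?_⟩
  intro k hk aj a e1 e2 e5 e6 Mh hMh P hP q hq Λ' hΛ' w u F Dd hw hu y hsupp
  have hn1 : 1 ≤ (ℓ + 1) ^ k := Nat.one_le_pow _ _ (by omega)
  have hN4 : 4 ≤ (ℓ + 1) ^ k * ((ℓ + 1) * Mh) := four_le_N hℓ hk hMh
  have hF : 0 ≤ F := (abs_nonneg _).trans (hu y)
  set M : ℝ := ((ℓ : ℝ) + 1) * Mh with hMdef
  have hM1 : (1 : ℝ) ≤ M := by
    have : (1 : ℝ) ≤ Mh := by exact_mod_cast hMh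
    have : (1 : ℝ) ≤ (ℓ : ℝ) + 1 := by linarith [(Nat.cast_nonneg ℓ : (0 : ℝ) ≤ ℓ)]
    rw [hMdef]; nlinarith
  have hMpos : 0 < M := by linarith
  have hM' : ∀ i, 1 ≤ cubeM' Mh P q i := fun i =>
    Nat.one_le_iff_ne_zero.2 (Nat.mul_ne_zero_iff.2 ⟨by omega, by have := (one_le_cubeW hP hq i).1; omega⟩)
  set κ₁ : ℝ := (d + 1) * D1 hprof / M with hκ₁
  set κ₂ : ℝ := (d + 1) * (D2 hprof / M ^ 2) with hκ₂
  have hκ₁0 : 0 ≤ κ₁ := by positivity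
  have hLip : ∀ z z' : ↥(Box d ℓ k (fun i => (ℓ + 1) * cubeM' Mh P q i)),
      |hLoc ℓ k Mh P q z' - hLoc ℓ k Mh P q z| ≤ κ₁ * supNorm (z'.1 - z.1) / (((ℓ + 1) ^ k : ℕ) : ℝ) := by
    intro z z'
    have := abs_hq_sub_le (d := d) hn1 (Nat.one_le_iff_ne_zero.2 (by positivity : (ℓ + 1) * Mh ≠ 0))
      (locLabel q) z.1 z'.1
    rw [hκ₁, hMdef]
    push_cast at this ⊢
    exact this
  have hLap : ∀ z : ↥(Box d ℓ k (fun i => (ℓ + 1) * cubeM' Mh P q i)),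
      |((((ℓ + 1) ^ k : ℕ) : ℝ)) ^ 2 * ∑ z' ∈ boxNbrs _ z, (hLoc ℓ k Mh P q z' - hLoc ℓ k Mh P q z)| ≤ κ₂ := by
    intro z
    obtain hcw := fun i => cubeW_cases hP hq i
    have hl := hloc_laplacian (d := d) (n := (ℓ + 1) ^ k) (M := (ℓ + 1) * Mh) hN4 (c := locLabel q)
      (w := fun i => cubeW P q i) (S := fun i => (ℓ + 1) ^ k * ((ℓ + 1) * cubeM' Mh P q i))
      (fun i => by simp only [cubeM']; ring) (fun i => (hcw i).1) (fun i => (hcw i).2) z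
    rw [abs_mul, abs_of_nonneg (by positivity)]
    have hNsq : ((((ℓ + 1) ^ k : ℕ) : ℝ)) ^ 2 * ((d + 1) * (D2 hprof / ((((ℓ + 1) ^ k * ((ℓ + 1) * Mh) : ℕ) : ℝ)) ^ 2))
        = κ₂ := by
      rw [hκ₂, hMdef]; push_cast
      have : (((ℓ : ℝ) + 1) ^ k) ≠ 0 := by positivity
      field_simp
    calc ((((ℓ + 1) ^ k : ℕ) : ℝ)) ^ 2 * |∑ z' ∈ boxNbrs _ z, (hLoc ℓ k Mh P q z' - hLoc ℓ k Mh P q z)|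
        ≤ ((((ℓ + 1) ^ k : ℕ) : ℝ)) ^ 2 * ((d + 1) * (D2 hprof / ((((ℓ + 1) ^ k * ((ℓ + 1) * Mh) : ℕ) : ℝ)) ^ 2)) :=
          mul_le_mul_of_nonneg_left hl (by positivity)
      _ = κ₂ := hNsq
  have hg : ∀ b, |(Matrix.diagonal w *ᵥ u) b| ≤ F := by
    intro b
    rw [Matrix.mulVec_diagonal, abs_mul]
    calc |w b| * |u b| ≤ 1 * F := mul_le_mul (hw b) (hu b) (abs_nonneg _) zero_le_one
      _ = F := one_mul _
  have hgsupp : ∀ b, (Matrix.diagonal w *ᵥ u) b ≠ 0 → Dd ≤ supNorm (y.1 - b.1) := by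
    intro b hb
    refine hsupp b fun h0 => hb ?_
    rw [Matrix.mulVec_diagonal, h0, mul_zero]
  have h := h244 k hk aj 0 a e1 e2 le_rfl le_rfl e5 e6 (cubeM' Mh P q) hM' Λ' hΛ' (hLoc ℓ k Mh P q) κ₁ κ₂ hκ₁0
    hLip hLap (Matrix.diagonal w *ᵥ u) F Dd hg y hgsupp
  rw [← Matrix.mulVec_mulVec, ← Matrix.mulVec_mulVec]
  refine h.trans (mul_le_mul_of_nonneg_right (mul_le_mul_of_nonneg_right ?_ (Real.exp_pos _).le) hF)
  -- `C(κ₁ + κ₂) ≤ C(d+1)(sup|h′| + sup|h″|)/M`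
  refine mul_le_mul_of_nonneg_left ?_ hC.le
  have hM2 : D2 hprof / M ^ 2 ≤ D2 hprof / M := by
    apply div_le_div_of_nonneg_left hD2 hMpos
    nlinarith
  have : (d + 1) * (D2 hprof / M ^ 2) ≤ (d + 1) * (D2 hprof / M) := mul_le_mul_of_nonneg_left hM2 (by positivity)
  calc κ₁ + κ₂ = (d + 1) * D1 hprof / M + (d + 1) * (D2 hprof / M ^ 2) := by rw [hκ₁, hκ₂]
    _ ≤ (d + 1) * D1 hprof / M + (d + 1) * (D2 hprof / M) := by linarith
    _ = (d + 1) * (D1 hprof + D2 hprof) / M := by rw [hMdef]; field_simp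

/-- **[B6] (2.49) FOR THE GENUINE `k`-LEVEL OPERATOR ON A BOX**: there is `C′ = C′(d, ℓ, windows) > 0` such that
`‖R‖_{∞→∞} ≤ C′/M` (`M = L·M_h`) for EVERY number of levels `k`, `M_h ≥ 3`, `R ≥ 2L`, volume `P`, nested family `D`
of domains (2.1)–(2.2) and weights `a_i ∈ [a₋, a₊]`, `c_i ∈ [c₋, c₊]` (`i ≥ 1`) — from (2.44) per cube
(`local_comm_bound`: the genuine two-level cube operator of the cube at its finer level `i ≥ 1`, cube half-width
`M_□ = M·L^{j−i} ≥ M`, `|v_□| ≤ 1`) and the finite overlap of the multi-size cover (`≤ 3·2^{d+1}` terms per row,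
`mem_keySet_of_bX_ne_zero`). [cite: Balaban1984PropagatorsII, (2.49) p.232] -/
theorem norm_rML_le (d ℓ : ℕ) (hℓ : 1 ≤ ℓ) (aminus aplus a2minus a2plus : ℝ) (ha : 0 < aminus) (ha2 : 0 < a2minus) :
    ∃ C' : ℝ, 0 < C' ∧ ∀ (k Mh R : ℕ), 3 ≤ Mh → 2 * (ℓ + 1) ≤ R → ∀ (P : Fin (d + 1) → ℕ) (hP : ∀ μ, 1 ≤ P μ)
      (D : Domains d ℓ Mh k P R) (a c : ℕ → ℝ), (∀ i, 1 ≤ i → aminus ≤ a i ∧ a i ≤ aplus) →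
        (∀ i, 1 ≤ i → a2minus ≤ c i ∧ c i ≤ a2plus) →
        ‖rML D a c hP‖ ≤ C' / (((ℓ : ℝ) + 1) * Mh) := by
  obtain ⟨δ', C, -, hC, hloc⟩ := local_comm_bound d ℓ hℓ aminus aplus a2minus a2plus ha ha2
  have hD1 := D1_nonneg contDiff_hprof hasCompactSupport_hprof
  have hD2 := D2_nonneg contDiff_hprof hasCompactSupport_hprof
  refine ⟨3 * 2 ^ (d + 1) * C * ((d + 1) * (D1 hprof + D2 hprof)) + 1, by positivity, ?_⟩
  intro k Mh R hMh hR P hP D a c haw hcw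
  have hMh1 : 1 ≤ Mh := le_trans (by norm_num) hMh
  set M : ℝ := ((ℓ : ℝ) + 1) * Mh with hMdef
  have hL1 : (1 : ℝ) ≤ (ℓ : ℝ) + 1 := by linarith [(Nat.cast_nonneg ℓ : (0 : ℝ) ≤ ℓ)]
  have hM1 : (1 : ℝ) ≤ M := by
    have : (1 : ℝ) ≤ Mh := by exact_mod_cast hMh1
    rw [hMdef]; nlinarith
  have hMpos : 0 < M := by linarith
  -- the uniform pointwise bound of one term
  set B : ℝ := C * ((d + 1) * (D1 hprof + D2 hprof) / M) with hBdef
  have hB0 : 0 ≤ B := by positivity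
  have hterm : ∀ (cq : ℕ × (Fin (d + 1) → ℤ)) (hc : CubeData D cq) (v : ↥(boxDom (N0 ℓ Mh k P)) → ℝ)
      (z : ↥(boxDom (N0 ℓ Mh k P))), |(bX D a c hP cq hc *ᵥ v) z| ≤ B * ‖v‖ := by
    intro cq hc v z
    obtain ⟨hi1, hij, hji, -, -⟩ := fin_data hc
    have hjk := hc.hj.2
    have hMh' : 1 ≤ MhP ℓ Mh cq.1 (fin D cq.1 cq.2) := one_le_MhP hMh1 _ _
    have hMhle : (Mh : ℝ) ≤ MhP ℓ Mh cq.1 (fin D cq.1 cq.2) := by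
      unfold MhP; exact_mod_cast Nat.le_mul_of_pos_right _ (by positivity)
    have hMM' : M ≤ ((ℓ : ℝ) + 1) * (MhP ℓ Mh cq.1 (fin D cq.1 cq.2) : ℝ) := by
      rw [hMdef]; exact mul_le_mul_of_nonneg_left hMhle (by linarith)
    -- the bound of this cube, `C(d+1)(…)/M_□ ≤ B`
    have hκ : C * ((d + 1) * (D1 hprof + D2 hprof) / (((ℓ : ℝ) + 1) * (MhP ℓ Mh cq.1 (fin D cq.1 cq.2) : ℝ))) ≤ B := by
      rw [hBdef]
      exact mul_le_mul_of_nonneg_left (div_le_div_of_nonneg_left (by positivity) hMpos hMM') hC.le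
    rw [bX_mulVec_apply]
    unfold innerB
    refine pad_mulVec_apply_le (one_le_Pj hP cq.1) hc.hq _ _ _ (mul_nonneg hB0 (norm_nonneg v)) fun y => ?_
    have hw : ∀ b, |((fun z => vFun D cq.1 cq.2 z.1) ∘ embC D hP cq hc) b| ≤ 1 := fun b => abs_vFun_le_one _ _ _
    have hu : ∀ b, |(res (embC D hP cq hc) *ᵥ (v ∘ castP (fin_data hc).2.1 hc.hj.2)) b| ≤ ‖v‖ := fun b => by
      rw [res_mulVec]; exact abs_apply_le_norm v _
    -- (the application is elaborated in stages: a one-shot application times out in `isDefEq`)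
    have h0 := hloc (fin D cq.1 cq.2) hi1 (a (fin D cq.1 cq.2)) (c (fin D cq.1 cq.2)) (haw _ hi1).1 (haw _ hi1).2
      (hcw _ hi1).1 (hcw _ hi1).2 (MhP ℓ Mh cq.1 (fin D cq.1 cq.2)) hMh' (Pj ℓ k P cq.1) (one_le_Pj hP cq.1) cq.2
      hc.hq (lamLoc ℓ (MhP ℓ Mh cq.1 (fin D cq.1 cq.2)) (Pj ℓ k P cq.1) cq.2 (one_le_Pj hP cq.1) hc.hq
        (LamG D cq.1 (fin D cq.1 cq.2)))
      (isBlockUnion_lamLoc _ hc.hq (isBlockUnion_LamG (D := D) hij hjk))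
    have h1 := h0 ((fun z => vFun D cq.1 cq.2 z.1) ∘ embC D hP cq hc)
      (res (embC D hP cq hc) *ᵥ (v ∘ castP (fin_data hc).2.1 hc.hj.2))
    have h2 := h1 ‖v‖ 0
    have h3 := h2 hw
    have h4 := h3 hu
    have h5 := h4 y
    have h := h5 (fun b _ => supNorm_nonneg _)
    rw [mul_zero, zero_div, neg_zero, Real.exp_zero, mul_one] at h
    unfold embC at h
    unfold cOp cG embC
    exact h.trans (mul_le_mul_of_nonneg_right hκ (norm_nonneg _))
  -- assembling the rows: at most `3·2^{d+1}` non-zero terms, each `≤ B‖v‖`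
  have hsum : ∀ (v : ↥(boxDom (N0 ℓ Mh k P)) → ℝ) (z : ↥(boxDom (N0 ℓ Mh k P))),
      |(rML D a c hP *ᵥ v) z| ≤ 3 * 2 ^ (d + 1) * B * ‖v‖ := by
    intro v z
    unfold rML
    rw [Matrix.sum_mulVec, Finset.sum_apply, Finset.attach_eq_univ]
    refine (Finset.abs_sum_le_sum_abs _ _).trans ?_
    have key := sum_le_card_mul
      (fun cq : {cq // cq ∈ cubeSet D} => |(bX D a c hP cq.1 (cubeData_of_mem cq.2) *ᵥ v) z|)
      (fun cq => cq.1) Subtype.val_injective (keySet ℓ Mh (D.lev z.1) z.1)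
      (fun cq hq0 => mem_keySet_of_bX_ne_zero hℓ hR hP hMh cq.1 (cubeData_of_mem cq.2) v
        (fun h0 => hq0 (by rw [h0, abs_zero])))
      (by positivity : 0 ≤ B * ‖v‖) (fun cq => hterm cq.1 (cubeData_of_mem cq.2) v z)
    refine key.trans ?_
    have hcard : ((keySet ℓ Mh (D.lev z.1) z.1).card : ℝ) ≤ 3 * 2 ^ (d + 1) := by
      exact_mod_cast card_keySet_le _ _ _ _
    have : 0 ≤ B * ‖v‖ := by positivity
    nlinarith
  refine (linfty_opNorm_le_of_pointwise _ (by positivity) hsum).trans ?_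
  rw [hBdef]
  calc 3 * 2 ^ (d + 1) * (C * ((d + 1) * (D1 hprof + D2 hprof) / M))
      = (3 * 2 ^ (d + 1) * C * ((d + 1) * (D1 hprof + D2 hprof))) / M := by ring
    _ ≤ (3 * 2 ^ (d + 1) * C * ((d + 1) * (D1 hprof + D2 hprof)) + 1) / M := by gcongr; linarith

end Ineq249

/-! ## §4 (2.50): the Neumann series converges to `G′ = Δ′_a^{−1}` -/

section Eq250

variable {ℓ Mh k R : ℕ} {P : Fin (d + 1) → ℕ}

/-- **THE LEVEL-0 WEIGHT IS IMMATERIAL**: since every site has level `≥ 1`, the `j = 0` term of `mlOp` vanishes, so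
`mlOp` only depends on `a_j`, `j ≥ 1` (print has no level `0` weight: `Λ₀` carries `λ = 0`).
[cite: Balaban1984PropagatorsII, (2.13)–(2.14) p.225, (2.3) p.224] -/
theorem mlOp_congr_weights {N : Fin (d + 1) → ℕ} {ℓ k : ℕ} {lev : (Fin (d + 1) → ℤ) → ℕ} (hlev : ∀ x, 1 ≤ lev x)
    {a a' : ℕ → ℝ} (h : ∀ j, 1 ≤ j → a j = a' j) : mlOp N ℓ k lev a = mlOp N ℓ k lev a' := by
  unfold mlOp
  congr 1
  refine Finset.sum_congr rfl fun j _ => ?_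
  rcases Nat.eq_zero_or_pos j with rfl | hj
  · have h0 : indLev N lev 0 = fun _ => 0 := by
      funext x
      simp only [indLev]
      rw [if_neg]
      have := hlev x.1
      omega
    rw [h0, Matrix.diagonal_zero, Matrix.zero_mul, Matrix.zero_mul, smul_zero, smul_zero]
  · unfold levC
    rw [h j hj]

/-- `G′·Δ′_a = 1` with positivity of the weights required at levels `≥ 1` only. [cite: Balaban1984PropagatorsII, p.225 («G′ = Δ′_a^{−1} is a well defined … operator»)] -/
theorem gml_mul_mlOp_pos {N : Fin (d + 1) → ℕ} {ℓ k : ℕ} {lev : (Fin (d + 1) → ℤ) → ℕ} (hN : ∀ i, 1 ≤ N i)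
    (hlev1 : ∀ x, 1 ≤ lev x) (hlevk : ∀ x, lev x ≤ k) {a : ℕ → ℝ} (ha : ∀ j, 1 ≤ j → 0 < a j) :
    gml N ℓ k lev a * mlOp N ℓ k lev a = 1 := by
  have h := mlOp_congr_weights (N := N) (ℓ := ℓ) (k := k) hlev1 (a := a)
    (a' := fun j => if j = 0 then 1 else a j) (fun j hj => by rw [if_neg (by omega)])
  have hpos : ∀ j, 0 < (fun j => if j = 0 then (1 : ℝ) else a j) j := fun j => by
    dsimp only
    split_ifs with h0
    · exact one_pos
    · exact ha j (Nat.pos_of_ne_zero h0)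
  unfold gml
  rw [h]
  exact gml_mul_mlOp hN hlevk hpos

/-- **[B6] (2.49) ⇒ «R has a small norm … for M sufficiently large» AND (2.50) `G′ = G′₀(I − R)^{−1} = G′₀Σ_nRⁿ` FOR THE
GENUINE `k`-LEVEL OPERATOR ON A BOX**: there is `M₀ = M₀(d, ℓ, windows) > 0` such that for EVERY `k`, `M_h ≥ 3` with
`L·M_h ≥ M₀`, `R ≥ 2L`, volume `P`, nested family `D` (2.1)–(2.2) and weights in the windows with
`a_{i+1} = aNext ℓ a_i c_i`: `‖R‖_{∞→∞} ≤ ½`; the series `G′₀Σ'_nRⁿ` is a right inverse of `Δ′_a`; it EQUALS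
`G′ = Δ′_a^{−1}` (`gml`); and `Σ_n G′₀Rⁿ` CONVERGES to `G′` in the `ℓ^∞` operator norm (p. 232 «Both series above
are convergent in the space L^∞»; the p. 234 sentence of Proposition 2.2, «convergent in the norms defined by these
inequalities», concerns the (2.67) norms and is not this theorem). [cite: Balaban1984PropagatorsII, (2.49)–(2.50) p.232] -/
theorem eq250_multiLevelBox (d ℓ : ℕ) (hℓ : 1 ≤ ℓ) (aminus aplus a2minus a2plus : ℝ) (ha : 0 < aminus)
    (ha2 : 0 < a2minus) :
    ∃ M₀ : ℝ, 0 < M₀ ∧ ∀ (k Mh R : ℕ), 3 ≤ Mh → M₀ ≤ ((ℓ : ℝ) + 1) * Mh → 2 * (ℓ + 1) ≤ R →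
      ∀ (P : Fin (d + 1) → ℕ) (hP : ∀ μ, 1 ≤ P μ) (D : Domains d ℓ Mh k P R) (a c : ℕ → ℝ),
        (∀ i, 1 ≤ i → aminus ≤ a i ∧ a i ≤ aplus) → (∀ i, 1 ≤ i → a2minus ≤ c i ∧ c i ≤ a2plus) →
        (∀ i, 1 ≤ i → a (i + 1) = aNext ℓ (a i) (c i)) →
        ‖rML D a c hP‖ ≤ 1 / 2
          ∧ mlOp (N0 ℓ Mh k P) ℓ k D.lev a * (gZeroML D a c hP * ∑' n : ℕ, rML D a c hP ^ n) = 1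
          ∧ gml (N0 ℓ Mh k P) ℓ k D.lev a = gZeroML D a c hP * ∑' n : ℕ, rML D a c hP ^ n
          ∧ HasSum (fun n : ℕ => gZeroML D a c hP * rML D a c hP ^ n) (gml (N0 ℓ Mh k P) ℓ k D.lev a) := by
  obtain ⟨C', hC', h249⟩ := norm_rML_le d ℓ hℓ aminus aplus a2minus a2plus ha ha2
  refine ⟨2 * C', by positivity, ?_⟩
  intro k Mh R hMh hM hR P hP D a c haw hcw hac
  haveI : CompleteSpace (Matrix ↥(boxDom (N0 ℓ Mh k P)) ↥(boxDom (N0 ℓ Mh k P)) ℝ) :=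
    FiniteDimensional.complete ℝ _
  have hMh1 : 1 ≤ Mh := le_trans (by norm_num) hMh
  have hRn : ‖rML D a c hP‖ ≤ 1 / 2 := by
    calc ‖rML D a c hP‖ ≤ C' / (((ℓ : ℝ) + 1) * Mh) := h249 k Mh R hMh hR P hP D a c haw hcw
      _ ≤ C' / (2 * C') := div_le_div_of_nonneg_left hC'.le (by positivity) hM
      _ = 1 / 2 := by field_simp
  have hR1 : ‖rML D a c hP‖ < 1 := by linarith
  -- (2.38) and the right inverse
  have h238 := eq238_multiLevelBox (D := D) (a := a) (c := c) hℓ hR hP hMh1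
    (fun i hi => lt_of_lt_of_le ha (haw i hi).1) (fun i hi => lt_of_lt_of_le ha2 (hcw i hi).1) hac
  have hright : mlOp (N0 ℓ Mh k P) ℓ k D.lev a * (gZeroML D a c hP * ∑' n : ℕ, rML D a c hP ^ n) = 1 := by
    rw [← mul_assoc, h238]
    exact mul_neg_geom_series _ hR1
  -- `G′Δ′_a = 1`, hence `G′ =` the series
  have hGE : gml (N0 ℓ Mh k P) ℓ k D.lev a * mlOp (N0 ℓ Mh k P) ℓ k D.lev a = 1 :=
    gml_mul_mlOp_pos (fun μ => Nat.one_le_iff_ne_zero.2 (by have := hP μ; positivity)) D.one_le_lev D.lev_le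
      (fun i hi => lt_of_lt_of_le ha (haw i hi).1)
  have hleft : gml (N0 ℓ Mh k P) ℓ k D.lev a = gZeroML D a c hP * ∑' n : ℕ, rML D a c hP ^ n := by
    calc gml (N0 ℓ Mh k P) ℓ k D.lev a
        = gml (N0 ℓ Mh k P) ℓ k D.lev a
            * (mlOp (N0 ℓ Mh k P) ℓ k D.lev a * (gZeroML D a c hP * ∑' n : ℕ, rML D a c hP ^ n)) := by
          rw [hright, mul_one]
      _ = gZeroML D a c hP * ∑' n : ℕ, rML D a c hP ^ n := by rw [← mul_assoc, hGE, one_mul]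
  refine ⟨hRn, hright, hleft, ?_⟩
  rw [hleft]
  exact (summable_geometric_of_norm_lt_one hR1).hasSum.mul_left _

end Eq250

end

end Literature.MathematicalPhysics.QuantumFieldTheory.Balaban1983to89.B6Ineq249MultiLevelBox
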